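import Summits.BirchSwinnertonDyer.BirchSwinnertonDyer.Theorems.CMKolyvaginAtInertTwoHabitatBSDTwoOnSelmerRankOneOfOneBitR0
import Summits.BirchSwinnertonDyer.BirchSwinnertonDyer.Theorems.CMKolyvaginAtInertTwoSilentSupplyOnSelmerRankOneOfBurungaleTian
import Literature.NumberTheory.EllipticCurves.Wuthrich2014.ShaBoundProofs
import HarnessLib

/-!
# Route `CMKolyvaginAtInertTwo` (leaf `WAllCornerFTwo`, habitat H₂) — THE HABITAT BY ITEMS, PER CURVE, AND UP TO ISOGENY

Seat `bsd-line-cmk2-p1` g24 (cell `bsd-print-cf2`), `--supports stmt-BirchSwinnertonDyer-28176` (helper; closes nothing by name).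
THEOREMS ONLY (no definition, no named fact, no `sorry`).  BSD is NOT proved by this; `WAllCornerFTwo` is NOT closed by this.

WHAT THIS FILE RECORDS (for the pen's next consolidated edit of `closes`, director (481)(a)).  §0: on H₂, `#Sel₂(E/ℚ) = 2 ↔ Ш(E/ℚ)(2) = ⊥`
(`natCard_selmerGroup_two_eq_two_iff_primaryComponent_sha_two_eq_bot`; descent count + `E(ℚ)[2] = 0`).  After g23 (p766325, p766676) the
habitat conjunct of the route's deciding theorem needs, PER CURVE `W ∈ H₂` (CM, `2` inert in `F`, `ρ̄_{W,2}` onto, `r_an = 1`, odd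
Tamagawa product, an `X₀(N)`-optimal frame with odd Manin constant):
* on `#Sel₂(W/ℚ) = 2` (⟺ `Ш(W/ℚ)[2] = 0`): ONLY the trivial-Ш Kolyvagin input R0 AT `W` (the body of item 28176
  `CMHeegnerTwoPrimitiveOfTrivialShaTwo` for this one curve, even restricted to one-bit fields `Σ ≤ 1`) and six prints
  (Gross–Zagier, GZK, modularity, Milne any-model, Burungale–Flach 2024, Burungale–Tian 2026) —
  `bsdp_two_of_natCard_selmerGroup_eq_two_of_oneBitR0At_of_printedInputs` (per curve; g23's theorem took the global R0¹);
* on `#Sel₂(W/ℚ) ≠ 2`: R0 at `W`, the non-trivial-Ш input R1 AT `W` (body of item 28177 `CMKolyvaginDescentOfNontrivialShaTwo`),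
  the residual algebraic twist supply HL′₁ AT `W` («some prime `q` with `4N_W ∣ q + 1` and some prime `ℓ` with
  `corank_{ℤ_ℓ} Sel_{ℓ^∞}(W^{(−q)}/ℚ) = 0» — the pen's `CMSilentSupplyResidualOffSelmerTwo` text), Gross 1991 Prop. 3.7 (2) for the
  frames of `W`, and the six prints — `bsdp_two_of_perCurveInputs_of_printedInputs`.
BY NAME (route decls as binders): `bsdp_two_onSelmerRankOne_of_itemR0_of_printedInputs` (SEL2 branch from ITEM 28176 verbatim) and
`bsdp_two_onHabitat_of_items_of_printedInputs` (whole habitat from 28176 ∧ 28177 ∧ HL′₁ ∧ `Prop37ReductionCongruenceInertAll` ∧ prints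
— the habitat conjunct of `closes` with HL′ 28663 replaced by its residual HL′₁ and KC 24648 replaced by its two regimes).
UP TO ISOGENY: the frame clause `Λ_E = c·Λ_f` pins the `X₀(N)`-OPTIMAL curve of its isogeny class, so every non-optimal
`ℚ`-isogenous globally minimal `W′` of an H₂ curve sits in the residual 22838 as typed; Cassels' isogeny invariance of the BSD
quotient (print, `bsdRHS_eq_of_isIsogenous`) transports `BSDp W 2` to `BSDp W′ 2` —
`bsdp_two_of_isIsogenous_onHabitat_of_items_of_printedInputs`.  (So the pen may carve «`ℚ`-isogenous to an H₂ curve with a frame» out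
of 22838 at the price of one more print binder.)

References: [MazurRubin2010] Cor. 3.4 (i); [BurungaleTian2026] Thm. 1.1; [BurungaleFlach2024] Thm. 1.1, Cor. 2; [GrossZagier1986]
I (6.3), V §2; [Milne1972ArithmeticAV] Thm. 1; [Kramer1981] Prop. 3; [GrossLMS1991] §2–§4, Prop. 3.7 (2), §11; [McCallumLMS1991] §5;
[Cassels1965ArithmeticVIII]; [MilneADT2006] Thm. I.7.3; [Miller2011LMS] Def. 1.1.
-/

set_option autoImplicit false
-- the Theorems namespace of this sub repeats the summit name by design (D-0017 nested layout)
set_option linter.dupNamespace false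

noncomputable section

open scoped Classical

open WeierstrassCurve NumberField Literature.NumberTheory.EllipticCurves
  Literature.NumberTheory.EllipticCurves.ModularForms
  Literature.NumberTheory.EllipticCurves.Rank1Residual
  Summit.BirchSwinnertonDyer.Rank1Residual
open Literature.NumberTheory.EllipticCurves.GrossLMS1991 (prop37_2_reductionCongruence_inert)
open Summit.BirchSwinnertonDyer.BirchSwinnertonDyer.Theorems.CMExactDescent
open Summit.BirchSwinnertonDyer.BirchSwinnertonDyer.Theses.CMKolyvaginAtInertTwo
  (CMHeegnerTwoPrimitiveOfTrivialShaTwo CMKolyvaginDescentOfNontrivialShaTwo Prop37ReductionCongruenceInertAll)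

namespace Summit.BirchSwinnertonDyer.BirchSwinnertonDyer.Theorems.KolyvaginLowerTwo

/-! ## §0 The split `#Sel₂(E/ℚ) = 2` in Ш-currency -/

/-- **On H₂ the cell `#Sel₂(E/ℚ) = 2` is the cell `Ш(E/ℚ)[2^∞] = 0`.**  For `W/ℚ` elliptic with `ρ̄_{W,2}` onto (so `W(ℚ)[2] = 0`, tree theorem
`DokchitserDokchitser2012.forall_two_nsmul_of_hasSurjectiveModNGaloisRep_two`) and `r_an = 1` (so `rank W(ℚ) = 1`, GZK):
`#Sel₂(W/ℚ) = 2 ↔ Ш(W/ℚ)(2) = ⊥`, by the descent count `#Sel^{(2)} = 2^{rank}·#E(ℚ)[2]·#Ш[2]` (Silverman X.4.2).  Lets the pen phrase the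
HL′-split either way. [cite: SilvermanAEC2009, Thm. X.4.2] [cite: DokchitserDokchitserMathZ2012, Theorem (1), proof (first paragraph)] -/
theorem natCard_selmerGroup_two_eq_two_iff_primaryComponent_sha_two_eq_bot
    (hGZK : rank_eq_analyticRank_of_analyticRank_le_one) (W : WeierstrassCurve ℚ) [W.IsElliptic]
    (hρ2 : W.HasSurjectiveModNGaloisRep 2) (hr : W.analyticRank = 1) :
    Nat.card (W.selmerGroup 2) = 2 ↔ AddCommGroup.primaryComponent W.sha 2 = ⊥ := by
  haveI : Fact (Nat.Prime 2) := ⟨Nat.prime_two⟩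
  have hrank : W.mordellWeilRank = 1 := by rw [(hGZK W (by rw [hr])).1, hr]
  -- the tree's descent lemmas carry the classical `DecidableEq ℚ` in the group law on points; use it here too
  letI instC : DecidableEq ℚ := fun a b ↦ Classical.propDecidable (a = b)
  -- no rational `2`-torsion
  have ht : Nat.card (AddSubgroup.torsionBy W.toAffine.Point ((2 : ℕ) : ℤ)) = 1 := by
    have hbot : AddSubgroup.torsionBy W.toAffine.Point ((2 : ℕ) : ℤ) = ⊥ := by
      rw [eq_bot_iff]
      intro P hP
      rw [AddSubgroup.mem_bot]
      exact DokchitserDokchitser2012.forall_two_nsmul_of_hasSurjectiveModNGaloisRep_two W two_ne_zero hρ2 P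
        (AddSubgroup.torsionBy.nsmul_iff.mp hP)
    rw [hbot, AddSubgroup.card_bot]
  have hcard := W.natCard_selmerGroup_eq (n := 2) two_ne_zero
  rw [hrank, pow_one] at hcard
  -- `#Sel₂ = 2 · #E(ℚ)[2] · #Ш[2]`; read it in both directions without rewriting inside `hcard`
  have key : ∀ {A B : ℕ}, Nat.card (W.selmerGroup ((2 : ℕ) : ℤ)) = 2 * A * B → A = 1 → B = 1 →
      Nat.card (W.selmerGroup 2) = 2 := by
    intro A B h hA hB
    rw [hA, hB, mul_one, mul_one] at h
    exact h
  refine ⟨fun hSel ↦ primaryComponent_sha_eq_bot_of_card_selmerGroup_eq W 2 hSel hrank ht, fun hbot ↦ key hcard ht ?_⟩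
  have hinf : (W.sha ⊓ AddSubgroup.torsionBy W.galH1 ((2 : ℕ) : ℤ) : AddSubgroup W.galH1) = ⊥ := by
    rw [eq_bot_iff]
    intro x hx
    obtain ⟨hxS, hxT⟩ := AddSubgroup.mem_inf.mp hx
    rw [AddSubgroup.mem_bot]
    have h2x : 2 • (⟨x, hxS⟩ : W.sha) = 0 := Subtype.ext (AddSubgroup.torsionBy.nsmul_iff.mp hxT)
    have hmem : (⟨x, hxS⟩ : W.sha) ∈ AddCommGroup.primaryComponent W.sha 2 :=
      (AddCommGroup.mem_primaryComponent).mpr ⟨1, by rw [pow_one]; exact h2x⟩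
    rw [hbot, AddSubgroup.mem_bot] at hmem
    exact congrArg Subtype.val hmem
  rw [hinf]
  exact AddSubgroup.card_bot

/-! ## §1 The `#Sel₂(E) = 2` regime, PER CURVE: R0 at `W` (one-bit fields only) and six prints suffice -/

/-- **`BSD₂(E)` for ONE `E ∈ H₂` with `#Sel₂(E/ℚ) = 2`, from the trivial-Ш Kolyvagin input R0 AT THIS CURVE (one-bit Heegner fields
only) and six prints.**  Prints: Gross–Zagier (all levels), GZK, modularity (`exists_isNewformOf`), Milne any-model, Burungale–Flach
(`bsdTriple_of_hasCM_of_L_one_ne_zero`), Burungale–Tian 2026 (`burungaleTian_analyticRank_eq_zero_of_selmerCorank_eq_zero_of_hasCM`).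
`hR0W`: for every imaginary quadratic `K` with odd `d_K ≠ −3`, Heegner for `N_W`, `Σ_W(d_K) ≤ 1`, every optimal odd-Manin frame
`(Dt, β, ι, d₁)` with `y_K = P(1)` of infinite order: `Ш(W_K)(2) = ⊥ ⟹ y_K ∉ 2W(K[1])`.  Proof = g23's
`bsdp_two_onSelmerRankOne_of_oneBitR0_of_printedInputs` with the hypothesis used only at `W`: the Mazur–Rubin field `K = ℚ(√−ℓ)`
(`#Sel₂(W^{(d_K)}) = 1`, `L(W^{(d_K)},1) ≠ 0`, `Σ = 1`) has `Ш(W_K)(2) = ⊥` by the count identity, R0 at `W` gives `M₀ = 0`, and g0's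
exact descent with Burungale–Flach for the twin concludes.  CONDITIONAL on `hR0W` (open) and the prints; closes nothing by name.
[cite: MazurRubin2010, Cor. 3.4 (i)] [cite: BurungaleTian2026, Thm. 1.1] [cite: BurungaleFlach2024, Thm. 1.1 and Cor. 2]
[cite: GrossZagier1986, V.§2] [cite: Milne1972ArithmeticAV, Thm. 1] [cite: Kramer1981, Prop. 3] -/
theorem bsdp_two_of_natCard_selmerGroup_eq_two_of_oneBitR0At_of_printedInputs
    (hGZ : ∀ (N : ℕ) [NeZero N] (W : WeierstrassCurve ℚ) (K : Type) [Field K] [NumberField K], gross_zagier N W K)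
    (hGZK : rank_eq_analyticRank_of_analyticRank_le_one) (hnf : exists_isNewformOf)
    (hMilneC : Milne1972.bsdQuotient_baseChange_quadratic_anyModel) (hBF : bsdTriple_of_hasCM_of_L_one_ne_zero)
    (hBT : burungaleTian_analyticRank_eq_zero_of_selmerCorank_eq_zero_of_hasCM)
    (W : WeierstrassCurve ℚ) [W.IsElliptic] [W.IsGloballyMinimal] [NeZero (W.conductorNorm ℤ)]
    (hCM : W.HasCM) (hin : Rank1Residual.CMInert W 2) (hρ2 : W.HasSurjectiveModNGaloisRep 2) (hr : W.analyticRank = 1)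
    (hT : Odd W.tamagawaProduct)
    (hopt : ∃ Dt : ModularParametrizationData W (W.conductorNorm ℤ),
      (∀ z ∈ Dt.L.lattice, ∃ w ∈ periodLattice Dt.f, z = (Dt.c : ℂ) * w) ∧ Odd Dt.c)
    (hSel : Nat.card (W.selmerGroup 2) = 2)
    (hR0W : ∀ (K : Type) [Field K] [NumberField K], IsImaginaryQuadratic K → Odd (NumberField.discr K) →
      NumberField.discr K ≠ -3 → SatisfiesHeegnerHypothesis (W.conductorNorm ℤ) K →
      (∑ q ∈ (NumberField.discr K).natAbs.primeFactors, ((if jacobiSym W.Δ.num q = -1 then 1 else 0) +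
        (if jacobiSym W.Δ.num q = 1 ∧ Even (W.frobeniusTrace q) then 2 else 0)) ≤ 1) →
      ∀ (Dt : ModularParametrizationData W (W.conductorNorm ℤ)),
      (∀ z ∈ Dt.L.lattice, ∃ w ∈ periodLattice Dt.f, z = (Dt.c : ℂ) * w) → Odd Dt.c →
      ∀ (β : ℤ) (ι : K →+* ℂ) (d₁ : KolyvaginHeegnerData Dt β ι 1), ¬ IsOfFinAddOrder d₁.derivedPoint →
      AddCommGroup.primaryComponent (W.baseChange K).sha 2 = ⊥ →
      ¬ ∃ Q : (W.baseChange (ringClassField K ι 1)).toAffine.Point, (2 : ℤ) • Q = d₁.derivedPoint) :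
    BSDp W 2 := by
  haveI : Fact (Nat.Prime 2) := ⟨Nat.prime_two⟩
  have hmod : hasEntireLFunction_rat := hasEntireLFunction_rat_of_exists_isNewformOf hnf
  have hΔ : W.Δ < 0 := KolyvaginEigenTwo.Δ_neg_of_cmInert_two W hCM hin hρ2
  -- (1) the Mazur–Rubin Heegner field (g23)
  obtain ⟨K, _, _, hK, hodd, h3, hH, hdef, h1, hL⟩ :=
    exists_mazurRubinHeegnerField_of_natCard_selmerGroup_eq_two hBT hmod W hCM hin hρ2 hSel
  have hd0 : ((NumberField.discr K : ℤ) : ℚ) ≠ 0 := by exact_mod_cast NumberField.discr_ne_zero K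
  haveI := W.isElliptic_quadraticTwist hd0
  -- (2) the frame: `Dt`, `β`, `ι`, a Heegner datum `d₁` of conductor `1`, `y_K = P(1)` of infinite order (Gross–Zagier)
  obtain ⟨Dt, hDt, hc⟩ := hopt
  obtain ⟨β, hβ⟩ := exists_dvd_sq_sub_discr_holds (W.conductorNorm ℤ) K hK hH
  let ι : K →+* ℂ := Classical.choice inferInstance
  obtain ⟨d₁⟩ := exists_kolyvaginHeegnerData_one
    (phi_heegnerTau_mem_singularModuliField_holds (W.conductorNorm ℤ) W K) hK Dt β ι hβ
  have hy : ¬ IsOfFinAddOrder d₁.derivedPoint :=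
    CMSupply.not_isOfFinAddOrder_derivedPoint_one_of_rankOne hnf W K (hGZ _ W K) hK hH hr hL d₁
  -- (3) `Ш(W)(2) = ⊥`, `Ш(W^{(d_K)})(2) = ⊥`, and the count identity ⟹ `#Ш(W_K)(2) = 1`
  have hrank : W.mordellWeilRank = 1 := by rw [(hGZK W (by rw [hr])).1, hr]
  have hdesc := W.natCard_selmerGroup_eq (n := 2) two_ne_zero
  have hSel' : Nat.card (W.selmerGroup ((2 : ℕ) : ℤ)) = 2 := hSel
  rw [hSel', hrank, pow_one] at hdesc
  have hshaTors : Nat.card (W.sha ⊓ AddSubgroup.torsionBy W.galH1 ((2 : ℕ) : ℤ) : AddSubgroup W.galH1) = 1 := by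
    rw [mul_assoc] at hdesc
    have hab := Nat.eq_of_mul_eq_mul_left two_pos ((mul_one 2).trans hdesc)
    exact Nat.eq_one_of_mul_eq_one_left hab.symm
  have hShaW : AddCommGroup.primaryComponent W.sha 2 = ⊥ :=
    primaryComponent_sha_eq_bot_of_inf_torsionBy_eq_bot W 2 (AddSubgroup.eq_bot_of_card_eq _ hshaTors)
  have hShaD : AddCommGroup.primaryComponent (W.quadraticTwist ((NumberField.discr K : ℤ) : ℚ)).sha 2 = ⊥ :=
    primaryComponent_sha_eq_bot_of_natCard_selmerGroup_eq_one (W.quadraticTwist ((NumberField.discr K : ℤ) : ℚ)) 2 h1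
  obtain ⟨-, hid⟩ := ShaCountTwo.card_primaryComponent_sha_two_baseChange_mul_two_eq_of_heegnerData_of_facts hGZ hGZK hmod hMilneC
    W hρ2 K hK hodd hH Dt β ι d₁ hy
  rw [if_neg (not_lt.mpr hΔ.le), hShaW, hShaD, AddSubgroup.card_bot, AddSubgroup.card_bot, one_mul, mul_one, one_mul] at hid
  have hpow1 : 1 ≤ 2 ^ ∑ q ∈ (NumberField.discr K).natAbs.primeFactors,
      ((if jacobiSym W.Δ.num q = -1 then 1 else 0) + (if jacobiSym W.Δ.num q = 1 ∧ Even (W.frobeniusTrace q) then 2 else 0)) :=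
    Nat.one_le_two_pow
  have hpow2 : 2 ^ ∑ q ∈ (NumberField.discr K).natAbs.primeFactors,
      ((if jacobiSym W.Δ.num q = -1 then 1 else 0) + (if jacobiSym W.Δ.num q = 1 ∧ Even (W.frobeniusTrace q) then 2 else 0)) ≤ 2 ^ 1 :=
    Nat.pow_le_pow_right (by norm_num) hdef
  have hshaK : Nat.card (AddCommGroup.primaryComponent (W.baseChange K).sha 2) = 1 := by
    rw [pow_one] at hpow2
    omega
  have hshaK' : Nat.card (AddCommGroup.primaryComponent (W.baseChange K).sha 2) = 2 ^ (2 * 0) := by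
    rw [mul_zero, pow_zero]
    exact hshaK
  haveI hfinK : Finite (AddCommGroup.primaryComponent (W.baseChange K).sha 2) := Nat.finite_of_card_ne_zero (by omega)
  have hbotK : AddCommGroup.primaryComponent (W.baseChange K).sha 2 = ⊥ := AddSubgroup.eq_bot_of_card_eq _ hshaK
  -- R0 at `W`: `y_K ∉ 2W(K[1])`, i.e. `M₀ = 0`
  have hprim : ¬ ∃ Q : (W.baseChange (ringClassField K ι 1)).toAffine.Point, (2 : ℤ) • Q = d₁.derivedPoint :=
    hR0W K hK hodd h3 hH hdef Dt hDt hc β ι d₁ hy hbotK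
  have hM₀ : ∃ Q : (W.baseChange (ringClassField K ι 1)).toAffine.Point, ((2 ^ 0 : ℕ) : ℤ) • Q = d₁.derivedPoint :=
    ⟨d₁.derivedPoint, by rw [pow_zero, Nat.cast_one, one_smul]⟩
  have hndiv : ¬ ∃ Q : (W.baseChange (ringClassField K ι 1)).toAffine.Point, ((2 ^ (0 + 1) : ℕ) : ℤ) • Q = d₁.derivedPoint := by
    rw [zero_add, pow_one]
    exact_mod_cast hprim
  -- (4) the twin and g0's exact descent
  obtain ⟨Wd, _, _, hWd, hcmd, hrd⟩ := CMSupply.exists_minimal_twin_hasCM_analyticRank_zero hnf W hCM K hL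
  have hBd : BSDp Wd 2 := Summit.BirchSwinnertonDyer.Rank1Residual.bsdp_cm_rankZero (p := 2) hBF hmod hcmd hrd
  exact cmExactDescentAtTwo_of_facts hGZ hGZK hmod hMilneC W hCM hin hρ2 hr hT K hK hodd h3 hH Dt hDt hc β ι d₁ hy 0 hM₀ hndiv hshaK'
    Wd hWd hBd

/-- **The SEL2 branch BY NAME from the R0 ITEM: (six prints) ∧ `CMHeegnerTwoPrimitiveOfTrivialShaTwo` (stmt-28176, verbatim) ⟹
`BSDp W 2` for every `W ∈ H₂` with `#Sel₂(W/ℚ) = 2`.**  (28176 quantifies over ALL odd Heegner `d_K ≠ −3`; only one-bit fields are used.)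
No HL′ (28663), no R1 (28177), no Kolyvagin prime, no Prop. 3.7 (2) on this regime.  CONDITIONAL on 28176 (open) and the prints;
closes nothing by name. [cite: MazurRubin2010, Cor. 3.4 (i)] [cite: BurungaleTian2026, Thm. 1.1] [cite: BurungaleFlach2024, Cor. 2] -/
theorem bsdp_two_onSelmerRankOne_of_itemR0_of_printedInputs
    (hGZ : ∀ (N : ℕ) [NeZero N] (W : WeierstrassCurve ℚ) (K : Type) [Field K] [NumberField K], gross_zagier N W K)
    (hGZK : rank_eq_analyticRank_of_analyticRank_le_one) (hnf : exists_isNewformOf)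
    (hMilneC : Milne1972.bsdQuotient_baseChange_quadratic_anyModel) (hBF : bsdTriple_of_hasCM_of_L_one_ne_zero)
    (hBT : burungaleTian_analyticRank_eq_zero_of_selmerCorank_eq_zero_of_hasCM)
    (hR0 : CMHeegnerTwoPrimitiveOfTrivialShaTwo)
    (W : WeierstrassCurve ℚ) [W.IsElliptic] [W.IsGloballyMinimal] [NeZero (W.conductorNorm ℤ)]
    (hCM : W.HasCM) (hin : Rank1Residual.CMInert W 2) (hρ2 : W.HasSurjectiveModNGaloisRep 2) (hr : W.analyticRank = 1)
    (hT : Odd W.tamagawaProduct)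
    (hopt : ∃ Dt : ModularParametrizationData W (W.conductorNorm ℤ),
      (∀ z ∈ Dt.L.lattice, ∃ w ∈ periodLattice Dt.f, z = (Dt.c : ℂ) * w) ∧ Odd Dt.c)
    (hSel : Nat.card (W.selmerGroup 2) = 2) :
    BSDp W 2 :=
  bsdp_two_of_natCard_selmerGroup_eq_two_of_oneBitR0At_of_printedInputs hGZ hGZK hnf hMilneC hBF hBT W hCM hin hρ2 hr hT hopt hSel
    (fun K _ _ hK hodd h3 hH _ Dt hDt hc β ι d₁ hy hbot ↦ hR0 W hCM hin hρ2 hr hT K hK hodd h3 hH Dt hDt hc β ι d₁ hy hbot)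

/-! ## §2 The whole habitat, PER CURVE: R0 at `W`, and — only off `#Sel₂(W) = 2` — R1 at `W`, HL′₁ at `W`, Prop. 3.7 (2) at `W` -/

/-- **`BSD₂(E)` for ONE `E ∈ H₂` from its own Kolyvagin inputs.**  `W ∈ H₂` (CM, `2` inert, `ρ̄₂` onto, `r_an = 1`, odd Tamagawa, an
optimal odd-Manin frame).  Inputs AT `W` (one-bit Heegner fields `Σ ≤ 1` only): R0 (`hR0W`: `Ш(W_K)(2) = ⊥ ⟹ y_K ∉ 2W(K[1])`) always;
and, ONLY when `#Sel₂(W/ℚ) ≠ 2` (`Ш(W/ℚ)[2] ≠ 0`): R1 (`hR1W`: `Ш(W_K)(2) ≠ ⊥ ⟹` a `2`-primitive derived class `P(n)` on CM-inert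
Kolyvagin primes), the residual algebraic twist supply HL′₁ (`hHLW`: a prime `q` with `4N_W ∣ q + 1` and a prime `ℓ` with
`corank_{ℤ_ℓ} Sel_{ℓ^∞}(W^{(−q)}) = 0`), and Gross 1991 Prop. 3.7 (2) for the frames of `W` (`h37W`, print).  Prints: GZ, GZK, modularity,
Milne any-model, Burungale–Flach, Burungale–Tian.  PROOF: on `#Sel₂ = 2`, §1; otherwise Burungale–Tian turns `hHLW` into
`L(W^{(−q)},1) ≠ 0`, g22's `exists_silentHeegnerField_of_prime_twist` gives the one-bit Heegner field `K = ℚ(√−q)`, the frame is built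
by Darmon 3.6 / Gross–Zagier, R0/R1 at `W` give the certificate (excluded middle on `Ш(W_K)(2) = ⊥`, witness `n = 1` in the first case),
and g22's certificate door `bsdp_two_of_exists_certificate_of_sum_defect_le_one_of_printedInputs` (exactness on `Σ ≤ 1` + g0's descent +
Burungale–Flach) concludes.  CONDITIONAL on the displayed inputs; closes nothing by name; BSD is NOT proved by this.
[cite: BurungaleTian2026, Thm. 1.1] [cite: GrossLMS1991, §11 and Prop. 3.7 (2)] [cite: McCallumLMS1991, §5 Thm. 5.4]
[cite: GrossZagier1986, I.6.3] [cite: Darmon2004, Thm. 3.6] [cite: BurungaleFlach2024, Thm. 1.1 and Cor. 2] -/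
theorem bsdp_two_of_perCurveInputs_of_printedInputs
    (hGZ : ∀ (N : ℕ) [NeZero N] (W : WeierstrassCurve ℚ) (K : Type) [Field K] [NumberField K], gross_zagier N W K)
    (hGZK : rank_eq_analyticRank_of_analyticRank_le_one) (hnf : exists_isNewformOf)
    (hMilneC : Milne1972.bsdQuotient_baseChange_quadratic_anyModel) (hBF : bsdTriple_of_hasCM_of_L_one_ne_zero)
    (hBT : burungaleTian_analyticRank_eq_zero_of_selmerCorank_eq_zero_of_hasCM)
    (W : WeierstrassCurve ℚ) [W.IsElliptic] [W.IsGloballyMinimal] [NeZero (W.conductorNorm ℤ)]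
    (hCM : W.HasCM) (hin : Rank1Residual.CMInert W 2) (hρ2 : W.HasSurjectiveModNGaloisRep 2) (hr : W.analyticRank = 1)
    (hT : Odd W.tamagawaProduct)
    (hopt : ∃ Dt : ModularParametrizationData W (W.conductorNorm ℤ),
      (∀ z ∈ Dt.L.lattice, ∃ w ∈ periodLattice Dt.f, z = (Dt.c : ℂ) * w) ∧ Odd Dt.c)
    (hR0W : ∀ (K : Type) [Field K] [NumberField K], IsImaginaryQuadratic K → Odd (NumberField.discr K) →
      NumberField.discr K ≠ -3 → SatisfiesHeegnerHypothesis (W.conductorNorm ℤ) K →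
      (∑ q ∈ (NumberField.discr K).natAbs.primeFactors, ((if jacobiSym W.Δ.num q = -1 then 1 else 0) +
        (if jacobiSym W.Δ.num q = 1 ∧ Even (W.frobeniusTrace q) then 2 else 0)) ≤ 1) →
      ∀ (Dt : ModularParametrizationData W (W.conductorNorm ℤ)),
      (∀ z ∈ Dt.L.lattice, ∃ w ∈ periodLattice Dt.f, z = (Dt.c : ℂ) * w) → Odd Dt.c →
      ∀ (β : ℤ) (ι : K →+* ℂ) (d₁ : KolyvaginHeegnerData Dt β ι 1), ¬ IsOfFinAddOrder d₁.derivedPoint →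
      AddCommGroup.primaryComponent (W.baseChange K).sha 2 = ⊥ →
      ¬ ∃ Q : (W.baseChange (ringClassField K ι 1)).toAffine.Point, (2 : ℤ) • Q = d₁.derivedPoint)
    (hR1W : Nat.card (W.selmerGroup 2) ≠ 2 → ∀ (K : Type) [Field K] [NumberField K], IsImaginaryQuadratic K →
      Odd (NumberField.discr K) → NumberField.discr K ≠ -3 → SatisfiesHeegnerHypothesis (W.conductorNorm ℤ) K →
      (∑ q ∈ (NumberField.discr K).natAbs.primeFactors, ((if jacobiSym W.Δ.num q = -1 then 1 else 0) +
        (if jacobiSym W.Δ.num q = 1 ∧ Even (W.frobeniusTrace q) then 2 else 0)) ≤ 1) →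
      ∀ (Dt : ModularParametrizationData W (W.conductorNorm ℤ)),
      (∀ z ∈ Dt.L.lattice, ∃ w ∈ periodLattice Dt.f, z = (Dt.c : ℂ) * w) → Odd Dt.c →
      ∀ (β : ℤ) (ι : K →+* ℂ) (d₁ : KolyvaginHeegnerData Dt β ι 1), ¬ IsOfFinAddOrder d₁.derivedPoint →
      AddCommGroup.primaryComponent (W.baseChange K).sha 2 ≠ ⊥ →
      ∃ (n : ℕ) (d : KolyvaginHeegnerData Dt β ι n), Squarefree n ∧
        (∀ ℓ ∈ n.primeFactors, Zhang2014.IsKolyvaginPrime (W.conductorNorm ℤ) W K 2 ℓ ∧ Rank1Residual.CMInert W ℓ) ∧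
        ¬ ∃ Q : (W.baseChange (ringClassField K ι n)).toAffine.Point, (2 : ℤ) • Q = d.derivedPoint)
    (hHLW : Nat.card (W.selmerGroup 2) ≠ 2 →
      ∃ q : ℕ, q.Prime ∧ (4 * W.conductorNorm ℤ : ℕ) ∣ q + 1 ∧ ∃ ℓ : ℕ, ℓ.Prime ∧ (W.quadraticTwist (-(q : ℚ))).selmerCorank ℓ = 0)
    (h37W : Nat.card (W.selmerGroup 2) ≠ 2 → ∀ (K : Type) [Field K] [NumberField K],
      prop37_2_reductionCongruence_inert (W.conductorNorm ℤ) W K) :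
    BSDp W 2 := by
  by_cases hSel : Nat.card (W.selmerGroup 2) = 2
  · exact bsdp_two_of_natCard_selmerGroup_eq_two_of_oneBitR0At_of_printedInputs hGZ hGZK hnf hMilneC hBF hBT W hCM hin hρ2 hr hT
      hopt hSel hR0W
  · have hmod : hasEntireLFunction_rat := hasEntireLFunction_rat_of_exists_isNewformOf hnf
    -- HL′₁ at `W` + Burungale–Tian ⟹ `L(W^{(−q)},1) ≠ 0` ⟹ the one-bit Heegner field `K = ℚ(√−q)` (g22)
    obtain ⟨q, hq, hdvd, ℓ, hℓ, h0⟩ := hHLW hSel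
    have hq0 : (-(q : ℚ)) ≠ 0 := neg_ne_zero.mpr (by exact_mod_cast hq.ne_zero)
    haveI := W.isElliptic_quadraticTwist hq0
    haveI : Fact ℓ.Prime := ⟨hℓ⟩
    have hCMd : (W.quadraticTwist (-(q : ℚ))).HasCM := (hasCM_iff_of_j_eq (W.j_quadraticTwist hq0)).mpr hCM
    have hr0 : (W.quadraticTwist (-(q : ℚ))).analyticRank = 0 := hBT (W.quadraticTwist (-(q : ℚ))) hCMd ℓ h0
    have hLq : (W.quadraticTwist (-(q : ℚ))).entireLFunction 1 ≠ 0 :=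
      ((W.quadraticTwist (-(q : ℚ))).analyticRank_eq_zero_iff_holds (hmod _)).mp hr0
    obtain ⟨K, _, _, hK, hodd, h3, hH, hdef, hL⟩ := exists_silentHeegnerField_of_prime_twist W hCM hin hρ2 hq hdvd hLq
    -- the frame `(Dt, β, ι, d₁)` with `y_K` of infinite order
    obtain ⟨Dt, hDt, hc⟩ := hopt
    obtain ⟨β, hβ⟩ := exists_dvd_sq_sub_discr_holds (W.conductorNorm ℤ) K hK hH
    let ι : K →+* ℂ := Classical.choice inferInstance
    obtain ⟨d₁⟩ := exists_kolyvaginHeegnerData_one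
      (phi_heegnerTau_mem_singularModuliField_holds (W.conductorNorm ℤ) W K) hK Dt β ι hβ
    have hy : ¬ IsOfFinAddOrder d₁.derivedPoint :=
      CMSupply.not_isOfFinAddOrder_derivedPoint_one_of_rankOne hnf W K (hGZ _ W K) hK hH hr hL d₁
    -- the certificate from R0 / R1 at `W` (excluded middle on `Ш(W_K)(2) = ⊥`)
    have hcert : ∃ (n : ℕ) (d : KolyvaginHeegnerData Dt β ι n), Squarefree n ∧
        (∀ ℓ ∈ n.primeFactors, Zhang2014.IsKolyvaginPrime (W.conductorNorm ℤ) W K 2 ℓ ∧ Rank1Residual.CMInert W ℓ) ∧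
        ¬ ∃ Q : (W.baseChange (ringClassField K ι n)).toAffine.Point, (2 : ℤ) • Q = d.derivedPoint := by
      by_cases hSha : AddCommGroup.primaryComponent (W.baseChange K).sha 2 = ⊥
      · exact ⟨1, d₁, squarefree_one, by simp, hR0W K hK hodd h3 hH hdef Dt hDt hc β ι d₁ hy hSha⟩
      · exact hR1W hSel K hK hodd h3 hH hdef Dt hDt hc β ι d₁ hy hSha
    exact bsdp_two_of_exists_certificate_of_sum_defect_le_one_of_printedInputs hGZ hGZK hnf hMilneC hBF W hCM hin hρ2 hr hT K hK hodd
      h3 hH hdef (h37W hSel K) Dt hDt hc β ι d₁ hy hcert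

/-! ## §3 BY NAME: the habitat conjunct of `closes` from the items 28176 ∧ 28177 ∧ HL′₁ ∧ Prop. 3.7 (2) ∧ prints -/

/-- **THE HABITAT BY ITEMS.**  (six prints) ∧ `Prop37ReductionCongruenceInertAll` (28665, print) ∧ `CMHeegnerTwoPrimitiveOfTrivialShaTwo`
(28176) ∧ `CMKolyvaginDescentOfNontrivialShaTwo` (28177) ∧ HL′₁ (the pen's `CMSilentSupplyResidualOffSelmerTwo` text: the residual
algebraic twist supply on `{#Sel₂(W) ≠ 2}`) ⟹ `BSDp W 2` for every `W ∈ H₂` with an optimal odd-Manin frame — the habitat conjunct of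
the route's deciding theorem with HL′ (28663) replaced by its residual HL′₁ and KC (24648) by its two regimes; the supply 28664, the
exactness 28666/28667 and the descent 24154 are consumed as the tree theorems they are.  CONDITIONAL on 28176, 28177, HL′₁ (open)
and the prints; closes nothing by name; BSD is NOT proved by this. [cite: BurungaleTian2026, Thm. 1.1] [cite: GrossLMS1991, Prop. 3.7 (2)]
[cite: MazurRubin2010, Cor. 3.4 (i)] [cite: BurungaleFlach2024, Cor. 2] -/
theorem bsdp_two_onHabitat_of_items_of_printedInputs
    (hGZ : ∀ (N : ℕ) [NeZero N] (W : WeierstrassCurve ℚ) (K : Type) [Field K] [NumberField K], gross_zagier N W K)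
    (hGZK : rank_eq_analyticRank_of_analyticRank_le_one) (hnf : exists_isNewformOf)
    (hMilneC : Milne1972.bsdQuotient_baseChange_quadratic_anyModel) (hBF : bsdTriple_of_hasCM_of_L_one_ne_zero)
    (hBT : burungaleTian_analyticRank_eq_zero_of_selmerCorank_eq_zero_of_hasCM)
    (h37 : Prop37ReductionCongruenceInertAll) (hR0 : CMHeegnerTwoPrimitiveOfTrivialShaTwo) (hR1 : CMKolyvaginDescentOfNontrivialShaTwo)
    (hHL₁ : ∀ (W : WeierstrassCurve ℚ) [W.IsElliptic] [W.IsGloballyMinimal] [NeZero (W.conductorNorm ℤ)], W.HasCM →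
      Literature.NumberTheory.EllipticCurves.Rank1Residual.CMInert W 2 → W.HasSurjectiveModNGaloisRep (2 : ℤ) → W.analyticRank = 1 →
      Nat.card (W.selmerGroup 2) ≠ 2 → ∃ q : ℕ, q.Prime ∧ (4 * W.conductorNorm ℤ : ℕ) ∣ q + 1 ∧
        ∃ ℓ : ℕ, ℓ.Prime ∧ (W.quadraticTwist (-(q : ℚ))).selmerCorank ℓ = 0)
    (W : WeierstrassCurve ℚ) [W.IsElliptic] [W.IsGloballyMinimal] [NeZero (W.conductorNorm ℤ)]
    (hCM : W.HasCM) (hin : Rank1Residual.CMInert W 2) (hρ2 : W.HasSurjectiveModNGaloisRep 2) (hr : W.analyticRank = 1)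
    (hT : Odd W.tamagawaProduct)
    (hopt : ∃ Dt : ModularParametrizationData W (W.conductorNorm ℤ),
      (∀ z ∈ Dt.L.lattice, ∃ w ∈ periodLattice Dt.f, z = (Dt.c : ℂ) * w) ∧ Odd Dt.c) :
    BSDp W 2 :=
  bsdp_two_of_perCurveInputs_of_printedInputs hGZ hGZK hnf hMilneC hBF hBT W hCM hin hρ2 hr hT hopt
    (fun K _ _ hK hodd h3 hH _ Dt hDt hc β ι d₁ hy hbot ↦ hR0 W hCM hin hρ2 hr hT K hK hodd h3 hH Dt hDt hc β ι d₁ hy hbot)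
    (fun _ K _ _ hK hodd h3 hH _ Dt hDt hc β ι d₁ hy hne ↦ hR1 W hCM hin hρ2 hr hT K hK hodd h3 hH Dt hDt hc β ι d₁ hy hne)
    (fun hne ↦ hHL₁ W hCM hin hρ2 hr hne) (fun _ K _ _ ↦ h37 W K)

/-! ## §4 UP TO ISOGENY: the non-optimal members of the H₂ isogeny classes (Cassels) -/

/-- **THE HABITAT BY ITEMS, UP TO `ℚ`-ISOGENY.**  The frame clause `∀ z ∈ Λ_E, ∃ w ∈ Λ_f, z = c·w` (with `c Λ_f ⊆ Λ_E`) says `Λ_E = c·Λ_f`,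
i.e. `W` is the `X₀(N)`-optimal curve of its isogeny class; a non-optimal globally minimal `W′` isogenous to `W` admits no such frame and
falls, as the route is typed, into the residual 22838.  Cassels' isogeny invariance of the BSD quotient (`bsdRHS_eq_of_isIsogenous`, print)
with the isogeny invariance of `L` and of the rank (tree) transports `BSD(W,2)` to `BSD(W′,2)` in analytic rank `1`
(`Wuthrich2014.bsdp_of_isIsogenous`).  So: (six prints) ∧ Cassels ∧ 28665 ∧ 28176 ∧ 28177 ∧ HL′₁ ⟹ `BSDp W′ 2` for every globally minimal
`W′` that is `ℚ`-isogenous to a member `W` of H₂ carrying an optimal odd-Manin frame.  CONDITIONAL as §3 plus Cassels; closes nothing.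
[cite: Cassels1965ArithmeticVIII] [cite: MilneADT2006, Thm. I.7.3 and Remark I.7.4] [cite: Miller2011LMS, Def. 1.1 (arXiv:1010.2431 p. 3)] -/
theorem bsdp_two_of_isIsogenous_onHabitat_of_items_of_printedInputs
    (hGZ : ∀ (N : ℕ) [NeZero N] (W : WeierstrassCurve ℚ) (K : Type) [Field K] [NumberField K], gross_zagier N W K)
    (hGZK : rank_eq_analyticRank_of_analyticRank_le_one) (hnf : exists_isNewformOf)
    (hMilneC : Milne1972.bsdQuotient_baseChange_quadratic_anyModel) (hBF : bsdTriple_of_hasCM_of_L_one_ne_zero)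
    (hBT : burungaleTian_analyticRank_eq_zero_of_selmerCorank_eq_zero_of_hasCM) (hCassels : bsdRHS_eq_of_isIsogenous)
    (h37 : Prop37ReductionCongruenceInertAll) (hR0 : CMHeegnerTwoPrimitiveOfTrivialShaTwo) (hR1 : CMKolyvaginDescentOfNontrivialShaTwo)
    (hHL₁ : ∀ (W : WeierstrassCurve ℚ) [W.IsElliptic] [W.IsGloballyMinimal] [NeZero (W.conductorNorm ℤ)], W.HasCM →
      Literature.NumberTheory.EllipticCurves.Rank1Residual.CMInert W 2 → W.HasSurjectiveModNGaloisRep (2 : ℤ) → W.analyticRank = 1 →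
      Nat.card (W.selmerGroup 2) ≠ 2 → ∃ q : ℕ, q.Prime ∧ (4 * W.conductorNorm ℤ : ℕ) ∣ q + 1 ∧
        ∃ ℓ : ℕ, ℓ.Prime ∧ (W.quadraticTwist (-(q : ℚ))).selmerCorank ℓ = 0)
    (W W' : WeierstrassCurve ℚ) [W.IsElliptic] [W'.IsElliptic] [W.IsGloballyMinimal] [W'.IsGloballyMinimal]
    [NeZero (W.conductorNorm ℤ)] (hiso : IsIsogenous W' W)
    (hCM : W.HasCM) (hin : Rank1Residual.CMInert W 2) (hρ2 : W.HasSurjectiveModNGaloisRep 2) (hr : W.analyticRank = 1)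
    (hT : Odd W.tamagawaProduct)
    (hopt : ∃ Dt : ModularParametrizationData W (W.conductorNorm ℤ),
      (∀ z ∈ Dt.L.lattice, ∃ w ∈ periodLattice Dt.f, z = (Dt.c : ℂ) * w) ∧ Odd Dt.c) :
    BSDp W' 2 := by
  haveI : Fact (Nat.Prime 2) := ⟨Nat.prime_two⟩
  have hmod : hasEntireLFunction_rat := hasEntireLFunction_rat_of_exists_isNewformOf hnf
  have hW : BSDp W 2 :=
    bsdp_two_onHabitat_of_items_of_printedInputs hGZ hGZK hnf hMilneC hBF hBT h37 hR0 hR1 hHL₁ W hCM hin hρ2 hr hT hopt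
  obtain ⟨-, hfin⟩ := hGZK W (by rw [hr])
  exact Wuthrich2014.bsdp_of_isIsogenous hCassels hiso hfin (WeierstrassCurve.leadingLCoeff_ne_zero_holds (hmod W)) hW

/-! ## §5 For the pen: the residual 22838 shrinks by the isogeny classes of the habitat (glue, by name) -/

open Summit.BirchSwinnertonDyer.BirchSwinnertonDyer.Theses.CMKolyvaginAtInertTwo (OffHabitatCMResidualAtTwo) in
/-- **GLUE FOR A RESIDUAL RE-CUT.**  `OffHabitatCMResidualAtTwo` (22838, verbatim) ⟸ the habitat conclusion (`hHab`, = §3 from the items)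
∧ Cassels' isogeny invariance ∧ GZK ∧ modularity (prints) ∧ the SMALLER residual `hRes'` (CM, `r_an = 1`, off H₂, and NOT `ℚ`-isogenous to a
framed member of H₂).  Excluded middle on «`∃` framed `W₀ ∈ H₂` isogenous to `W`», then §4's transport.  So the pen may replace 22838 by `hRes'`'s
text at the price of the binder `bsdRHS_eq_of_isIsogenous`.  Nothing is proved about the residual; BSD is NOT proved by this.
[cite: Cassels1965ArithmeticVIII] [cite: MilneADT2006, Thm. I.7.3 and Remark I.7.4] -/
theorem offHabitatCMResidualAtTwo_of_habitat_of_isogenyResidual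
    (hGZK : rank_eq_analyticRank_of_analyticRank_le_one) (hnf : exists_isNewformOf) (hCassels : bsdRHS_eq_of_isIsogenous)
    (hHab : ∀ (W₀ : WeierstrassCurve ℚ) [W₀.IsElliptic] [W₀.IsGloballyMinimal] [NeZero (W₀.conductorNorm ℤ)], W₀.HasCM →
      Rank1Residual.CMInert W₀ 2 → W₀.HasSurjectiveModNGaloisRep (2 : ℤ) → W₀.analyticRank = 1 → Odd W₀.tamagawaProduct →
      (∃ Dt : ModularParametrizationData W₀ (W₀.conductorNorm ℤ),
        (∀ z ∈ Dt.L.lattice, ∃ w ∈ periodLattice Dt.f, z = (Dt.c : ℂ) * w) ∧ Odd Dt.c) → BSDp W₀ 2)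
    (hRes' : ∀ (W : WeierstrassCurve ℚ) [W.IsElliptic] [W.IsGloballyMinimal] [NeZero (W.conductorNorm ℤ)], W.HasCM → W.analyticRank = 1 →
      ¬ (Rank1Residual.CMInert W 2 ∧ W.HasSurjectiveModNGaloisRep (2 : ℤ) ∧ Odd W.tamagawaProduct ∧
        ∃ Dt : ModularParametrizationData W (W.conductorNorm ℤ), (∀ z ∈ Dt.L.lattice, ∃ w ∈ periodLattice Dt.f, z = (Dt.c : ℂ) * w) ∧ Odd Dt.c) →
      (¬ ∃ (W₀ : WeierstrassCurve ℚ) (_ : W₀.IsElliptic) (_ : W₀.IsGloballyMinimal) (_ : NeZero (W₀.conductorNorm ℤ)),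
        IsIsogenous W W₀ ∧ W₀.HasCM ∧ Rank1Residual.CMInert W₀ 2 ∧ W₀.HasSurjectiveModNGaloisRep (2 : ℤ) ∧ Odd W₀.tamagawaProduct ∧
        ∃ Dt : ModularParametrizationData W₀ (W₀.conductorNorm ℤ), (∀ z ∈ Dt.L.lattice, ∃ w ∈ periodLattice Dt.f, z = (Dt.c : ℂ) * w) ∧ Odd Dt.c) →
      BSDp W 2) :
    OffHabitatCMResidualAtTwo := by
  intro W _ _ _ hCM hr hnot
  haveI : Fact (Nat.Prime 2) := ⟨Nat.prime_two⟩
  by_cases hiso : ∃ (W₀ : WeierstrassCurve ℚ) (_ : W₀.IsElliptic) (_ : W₀.IsGloballyMinimal) (_ : NeZero (W₀.conductorNorm ℤ)),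
      IsIsogenous W W₀ ∧ W₀.HasCM ∧ Rank1Residual.CMInert W₀ 2 ∧ W₀.HasSurjectiveModNGaloisRep (2 : ℤ) ∧ Odd W₀.tamagawaProduct ∧
      ∃ Dt : ModularParametrizationData W₀ (W₀.conductorNorm ℤ), (∀ z ∈ Dt.L.lattice, ∃ w ∈ periodLattice Dt.f, z = (Dt.c : ℂ) * w) ∧ Odd Dt.c
  · obtain ⟨W₀, _, _, _, hI, hCM₀, hin₀, hρ₀, hT₀, hfr₀⟩ := hiso
    have hmod : hasEntireLFunction_rat := hasEntireLFunction_rat_of_exists_isNewformOf hnf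
    have hr₀ : W₀.analyticRank = 1 := by rw [← analyticRank_eq_of_isIsogenous' hI]; exact hr
    obtain ⟨-, hfin₀⟩ := hGZK W₀ (by rw [hr₀])
    exact Wuthrich2014.bsdp_of_isIsogenous hCassels hI hfin₀ (WeierstrassCurve.leadingLCoeff_ne_zero_holds (hmod W₀))
      (hHab W₀ hCM₀ hin₀ hρ₀ hr₀ hT₀ hfr₀)
  · exact hRes' W hCM hr hnot hiso

end Summit.BirchSwinnertonDyer.BirchSwinnertonDyer.Theorems.KolyvaginLowerTwo

end
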